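import Mathlib
import Literature.MathematicalPhysics.QuantumFieldTheory.Balaban1983to89.B6Ineq268OneScaleTorus
import Literature.MathematicalPhysics.QuantumFieldTheory.Balaban1983to89.B4Sect5Torus

/-!
# `Balaban1983to89.B6QGGQInvTowerTorus` — T. Bałaban, *Propagators and renormalization transformations for lattice gauge
theories. II*, Commun. Math. Phys. **96** (1984) 223–250 [Balaban1984PropagatorsII], p. 235 and Proposition 2.3 p. 238: on the one-scale
tower torus, for the GENUINE `Q′_KG′_K²Q′_K*` (`G′_K = Δ′_a⁻¹`), **(a)** *"the operator Q′G′²Q′* is positive definite, so its inverse is well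
defined"* — PROVED; **(b)** the coercivity of `Q′G′²Q′*` FOLLOWS from that of `Q′G′Q′*` (squared constant); **(c)** PROPOSITION 2.3 VERBATIM
(`B6.Prop23Printed`) on the family for the genuine kernel `(Q′_KG′_K²Q′_K*)⁻¹(y,y′)` GIVEN ONE displayed input — a K- and volume-uniform
lower bound `Q′G′Q′* ≥ γ` (or `Q′G′²Q′* ≥ γ₀`; [3] (5.6) *"A ≥ γ₀I"*) — by [3] Sect. 5 (`B4Sect5Torus.inv_decay`) fed with (2.68)
(`B6Ineq268OneScaleTorus.ineq268_oneScaleTorus`, this seat) and the periodic ℓ¹ distance `T1`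

statement-level skeleton of published theorems with citation tags; proofs where landed; nothing here is a claim about the Yang–Mills mass gap.
PDF held: `paper:balaban1984-cmp96-propagators-rt-ii` (journal page = PDF page + 222); pp. 235, 238 [PDF 13, 16] read this lineage.

CITATION HEADER (cell `lit-balaban`, HOME `run/shared/lean/pub/lit-balaban/`; Phase-2 proof seat `p01` gen 6 = unit `lit-balaban-p01`;
`PHASE2-TARGETS.md` §G, G.5-34(d)).  SKELETON rows **`B6.Prop2.3`** (head proved-existing → proved p253194 on gen-5's torus family
`B6Prop23OneScaleTorus`, carriers `B5QGGQ145Bounds.Idx`) and **`B6.Eq2.68`**∕**`B6.Eq2.17`** (*"Q′G′²Q′* positive hence invertible"*) of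
`HOME/lit-balaban-r03/ROWS-B6.md` (owner r03, referee ref-4).  PURPOSE (owner's suggestion 07:30:20Z): Lemma 2.1 ∧ Prop 2.2 ∧ Prop 2.3 ALL
GENUINE ON ONE FAMILY, so that the edge `B6Ineq288Edge.ineq288_of_printed_lemma21` ((2.88)) instantiates non-vacuously — on the tower-torus
family of this seat's gen 6 (`B6Prop22OneScaleTorus.oneScaleGeo`/`Index`, carriers `Site P K`/`Site P 0`, where Lemma 2.1 (p260319) and
Prop 2.2 (p258648) are landed) this file delivers Prop 2.3 MODULO the uniform coercivity, and pins that input down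
(`lemma21_prop22_prop23_towerTorus_of_coercive`).  IMPORTED, NOT MODIFIED: `…B6Ineq268OneScaleTorus` ∕ `…B6Lemma21TowerTorus` ∕
`…B6Prop22OneScaleTorus` (this seat), `…B4Sect5Torus` (pv09: `Hyp56`, `IsPseudoDist`, `SumBound`, `inv_decay`, `rate`), `…QGQInverse` (r1:
`Coercive`), `…B1RG242Torus` (`tower`, `Qk`, `Qks`, `hOp`, `QkQks`, `G_arg`), `…B6` (`Prop23Printed`, `SiteKernel`).

WHAT THE PAPER PRINTS.  p. 235 [PDF 13]: *"Of course the operator Q′G′²Q′* is positive definite, so its inverse is well defined. We will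
construct it and investigate its properties using again a random walk expansion. Our considerations are analogous to Sect. 5 of [3],
concerning unit lattice operators. If we have one scale, i.e. Λ_k = T₁^{(k)}, then the operator is a unit lattice operator."*;
Proposition 2.3 p. 238 [PDF 16] (verbatim = docstring of `B6.Prop23Printed`): *"… |(Q′G′²Q′*)⁻¹(y, y′)| ≤ O(1)(L^jη)^{−4}(L^{j′}η)^{−d}
e^{−½δ₁d(y,y′)} (2.87)"*; [3] = Bałaban, CMP **89** (1983), Sect. 5 Theorem p. 594 (verbatim in `B4Sect5Torus`): *"A ≥ γ₀I,
|A(x, x′)| ≤ c₀e^{−δ₀|x−x′|} (5.6) … |C_Λ(x, x′)| ≤ c₁e^{−δ₁|x−x′|} (5.7)"*.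

WHAT IS PROVED HERE (0 `sorry`, 0 named facts; axioms standard), `P` a volume with `K ≥ 1`, `a > 0`, `m² ≥ 0`, `G′ := (tower P a m²).G K`:
* §1 `wQ`, `Qk_eq_smul_transpose` (`Q_K = L^{−Kd}·(Q_K*)ᵀ`), `transpose_Qks_mul_Qks`, `Qks_dot_Qks` (`‖Q*v‖² = L^{Kd}‖v‖²`);
* §2 `deltaPrimeK` (`Δ′ = −Δ^ε + m² + a_KQ*Q`), `deltaPrimeK_transpose`, `deltaPrimeK_isUnit` (`B1RG242Torus.G_arg`), `G_eq_inv`,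
  `G_transpose` (G′ symmetric), `deltaPrimeK_mul_G`, `G_mulVec_injective`;
* §3 `qggqK` (the matrix `Q′_KG′G′Q′_K*`), `qggqK_eq`, `qggqK_transpose`, **`form_qggqK`** (`⟨v, Q′G′²Q′*v⟩ = L^{−Kd}‖G′Q′*v‖² =
  ‖G′Q′*v‖²_η`, the η-adjoint reading (G′Q′*)*(G′Q′*)), `form_qgqK`, **`form_qggqK_pos`** + **`qggqK_isUnit`** — *"positive definite, so
  its inverse is well defined"* —, `cinvK` (the `B6.SiteKernel` `(Q′_KG′_K²Q′_K*)⁻¹(y,y′)` on `oneScaleGeo`), `cinvK_mul`∕`mul_cinvK`;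
  **`coercive_qggqK_of_qgqK`**: `Q′G′Q′* ≥ γ ≥ 0 ⇒ Q′G′²Q′* ≥ γ²` (Cauchy–Schwarz in the η-pairing, `‖Q′*v‖_η = ‖v‖`);
* §4 `T1_self`, `T1_isPseudoDist`, `T1_sumBound` (profile `c₀(t)^d` from `sum_exp_T1_le`), `hyp56_qggqK` ((5.6) for
  Q′G′²Q′* from a coercivity constant and (2.68)); **`prop23Printed_towerTorus_of_coercive`**: a uniform `γ₀` with `Q′_KG′_K²Q′_K* ≥ γ₀`
  on every member ⇒ `B6.Prop23Printed d (oneScaleGeo-family) (cinvK-family)` with M₁ = 1, δ₁ = 2·rate(c₀(·)^d, γ₀, C, δ₁^{(2.68)}),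
  O(1) = 2/γ₀ (`B4Sect5Torus.inv_decay`); **`prop23Printed_towerTorus_of_coercive_qgq`** (the same from `Q′_KG′_KQ′_K* ≥ γ`);
  **`lemma21_prop22_prop23_towerTorus_of_coercive`**: Lemma 2.1 ∧ Prop 2.2 ∧ Prop 2.3, all three verbatim census Props with GENUINE
  operators on ONE family, modulo that single input.
HONEST SCOPE.  The uniform lower bound `Q′G′Q′* ≥ γ` (equivalently a uniform approximate smooth right inverse of Q′_K with bounded
Δ′-energy, `QGQInverse.qgq_coercive_of_approx_right_inverse`; B5 p. 25–26 proves positivity by Fourier analysis) is NOT proved here — it is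
the one displayed hypothesis; per member, positivity (`form_qggqK_pos`) is proved but gives no uniform constant.  One scale, scalar
model, `m² ≥ 0`, `a > 0`; constants existential.  NOT summit progress.
-/

namespace Literature.MathematicalPhysics.QuantumFieldTheory.Balaban1983to89.B6QGGQInvTowerTorus

open Finset Matrix
open B1RG242Torus (tower Qk Qks hOp avgMat extMat lvl QkQks G_arg)
open B6Prop22OneScaleTorus (T1 oneScaleGeo torusGp Index gPrime_eq_deltaPrime_inv oneScaleGeo_len prop22Printed_oneScaleTorus)
open B6Lemma21TowerTorus (T1_triangle T1_symm sum_exp_T1_le lemma21Printed_towerTorus)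
open B6Ineq268OneScaleTorus (ineq268_oneScaleTorus)
open B4Sect5Torus (IsPseudoDist SumBound Hyp56 inv_decay rate rate_pos ccoord_self)
open B5Ineq137Torus (toT Nv)
open QGQInverse (Coercive)

noncomputable section

variable (P : Params)

/-! ## §1. `Q_K = L^{−Kd}·(Q_K*)ᵀ` and `‖Q*v‖² = L^{Kd}‖v‖²` -/

/-- The averaging weight `L^{−jd}` of `Q_j` (`B1RG242Torus.Qk`). [cite: Balaban1984PropagatorsII, (2.14) p.225; Balaban1982Higgs1, (2.11) p.609] -/
def wQ (j : ℕ) : ℝ := (((P.L : ℝ) ^ P.d)⁻¹) ^ lvl P j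

/-- `L^{−jd} > 0`. [cite: Balaban1984PropagatorsII, (2.14) p.225; bookkeeping] -/
theorem wQ_pos (j : ℕ) : 0 < wQ P j := pow_pos (inv_pos.mpr (pow_pos P.cast_L_pos _)) _

/-- **`Q_j = L^{−jd}·(Q_j*)ᵀ`**: the block average is the weight times the transpose of the block-constant extension (the (1.5)-adjointness
of [4] in matrix form). [cite: Balaban1984PropagatorsI, (1.5)+(1.7) p.18] -/
theorem Qk_eq_smul_transpose (j : ℕ) : Qk P j = wQ P j • (Qks P j)ᵀ := by
  ext y x
  simp only [Qk, Qks, avgMat, extMat, wQ, Matrix.smul_apply, Matrix.transpose_apply, smul_eq_mul, mul_ite, mul_one, mul_zero]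

/-- `L^{−jd}·(Q_j*)ᵀQ_j* = 1` (`Q_jQ_j* = 1`). [cite: Balaban1983RegularityDecay, (1.5) p.572] -/
theorem transpose_Qks_mul_Qks (j : ℕ) : wQ P j • ((Qks P j)ᵀ * Qks P j) = 1 := by
  rw [← Matrix.smul_mul, ← Qk_eq_smul_transpose]
  exact QkQks P j

/-- **`‖Q_j*v‖² = L^{jd}‖v‖²`** (plain sums on the fine torus; = `‖v‖²` in the η-pairing). [cite: Balaban1984PropagatorsI, (1.5) p.18] -/
theorem Qks_dot_Qks (j : ℕ) (v : Site P j → ℝ) : (Qks P j *ᵥ v) ⬝ᵥ (Qks P j *ᵥ v) = (wQ P j)⁻¹ * (v ⬝ᵥ v) := by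
  have h2 : (Qks P j)ᵀ * Qks P j = (wQ P j)⁻¹ • (1 : Matrix (Site P j) (Site P j) ℝ) := by
    rw [← transpose_Qks_mul_Qks P j, smul_smul, inv_mul_cancel₀ (wQ_pos P j).ne', one_smul]
  calc (Qks P j *ᵥ v) ⬝ᵥ (Qks P j *ᵥ v) = v ⬝ᵥ (((Qks P j)ᵀ * Qks P j) *ᵥ v) := by
        rw [← Matrix.mulVec_mulVec, Matrix.dotProduct_mulVec v (Qks P j)ᵀ, Matrix.vecMul_transpose]
    _ = (wQ P j)⁻¹ * (v ⬝ᵥ v) := by rw [h2, Matrix.smul_mulVec, Matrix.one_mulVec, dotProduct_smul, smul_eq_mul]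

/-! ## §2. `Δ′ = −Δ^ε + m² + a_KQ′_K*Q′_K` and `G′_K = Δ′⁻¹` are symmetric; `G′_K` is a two-sided inverse -/

/-- `Δ′_a = Δ + Q′*aQ′` on one scale: `−Δ^ε + m² + a_KQ_K*Q_K`, `a_K = B1.aSeq a L K` ((2.13)–(2.14); `G′_K = Δ′⁻¹` by
`B6Prop22OneScaleTorus.gPrime_eq_deltaPrime_inv`). [cite: Balaban1984PropagatorsII, (2.13) p.225] -/
def deltaPrimeK (a msq : ℝ) : Matrix (Site P 0) (Site P 0) ℝ :=
  hOp P 0 P.eps msq + B1.aSeq a P.L P.K • (Qks P P.K * Qk P P.K)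

/-- `−Δ^s + m² = m²·1 + Σ_μ ∂ᵀ_μ∂_μ` is a symmetric matrix. [cite: Balaban1982Higgs1, (1.11) p.605; bookkeeping] -/
theorem hOp_transpose (i : ℕ) (s msq : ℝ) : (hOp P i s msq)ᵀ = hOp P i s msq := by
  unfold hOp
  rw [Matrix.transpose_add, Matrix.transpose_smul, Matrix.transpose_one, Matrix.transpose_sum]
  congr 1
  refine Finset.sum_congr rfl fun μ _ => ?_
  rw [Matrix.transpose_mul, Matrix.transpose_transpose]

/-- `Q_j*Q_j = L^{−jd}·Q_j*(Q_j*)ᵀ` is symmetric. [cite: Balaban1984PropagatorsII, (2.13) p.225; bookkeeping] -/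
theorem QksQk_transpose (j : ℕ) : (Qks P j * Qk P j)ᵀ = Qks P j * Qk P j := by
  rw [Qk_eq_smul_transpose, Matrix.mul_smul, Matrix.transpose_smul, Matrix.transpose_mul, Matrix.transpose_transpose]

/-- `Δ′` is symmetric. [cite: Balaban1984PropagatorsII, (2.13) p.225; bookkeeping] -/
theorem deltaPrimeK_transpose (a msq : ℝ) : (deltaPrimeK P a msq)ᵀ = deltaPrimeK P a msq := by
  unfold deltaPrimeK
  rw [Matrix.transpose_add, Matrix.transpose_smul, hOp_transpose, QksQk_transpose]

/-- `Δ′` is invertible (`m² ≥ 0`, `a > 0`, `K ≥ 1`; `B1RG242Torus.G_arg`: harmonic with zero block averages ⇒ 0). [cite: Balaban1984PropagatorsII, (2.17) p.225 («G′ = Δ′_a⁻¹ … well defined»)] -/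
theorem deltaPrimeK_isUnit {a msq : ℝ} (ha : 0 < a) (hm : 0 ≤ msq) (hK : 1 ≤ P.K) : IsUnit (deltaPrimeK P a msq) := by
  have h := G_arg P ha hm P.K hK
  have hα : B1RG242Torus.α P a P.K = B1.aSeq a P.L P.K := by
    unfold B1RG242Torus.α
    rw [P.spacing_K, one_pow, inv_one, mul_one]
  rw [hα] at h
  exact h

/-- `G′_K = Δ′⁻¹`. [cite: Balaban1984PropagatorsII, (2.17) p.225] -/
theorem G_eq_inv {a msq : ℝ} (ha : 0 < a) (hm : 0 ≤ msq) (hK : 1 ≤ P.K) : (tower P a msq).G P.K = (deltaPrimeK P a msq)⁻¹ :=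
  gPrime_eq_deltaPrime_inv P ha hm hK

/-- **`G′_K` is a symmetric matrix** (inverse of the symmetric `Δ′`; self-adjoint for the η-pairing). [cite: Balaban1984PropagatorsII, (2.17) p.225; bookkeeping] -/
theorem G_transpose {a msq : ℝ} (ha : 0 < a) (hm : 0 ≤ msq) (hK : 1 ≤ P.K) :
    ((tower P a msq).G P.K)ᵀ = (tower P a msq).G P.K := by
  rw [G_eq_inv P ha hm hK, Matrix.transpose_nonsing_inv, deltaPrimeK_transpose]

/-- `Δ′G′_K = 1`. [cite: Balaban1984PropagatorsII, (2.17) p.225] -/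
theorem deltaPrimeK_mul_G {a msq : ℝ} (ha : 0 < a) (hm : 0 ≤ msq) (hK : 1 ≤ P.K) :
    deltaPrimeK P a msq * (tower P a msq).G P.K = 1 := by
  rw [G_eq_inv P ha hm hK]
  exact Matrix.mul_nonsing_inv _ ((Matrix.isUnit_iff_isUnit_det _).mp (deltaPrimeK_isUnit P ha hm hK))

/-- `G′_KΔ′ = 1`. [cite: Balaban1984PropagatorsII, (2.17) p.225] -/
theorem G_mul_deltaPrimeK {a msq : ℝ} (ha : 0 < a) (hm : 0 ≤ msq) (hK : 1 ≤ P.K) :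
    (tower P a msq).G P.K * deltaPrimeK P a msq = 1 := by
  rw [G_eq_inv P ha hm hK]
  exact Matrix.nonsing_inv_mul _ ((Matrix.isUnit_iff_isUnit_det _).mp (deltaPrimeK_isUnit P ha hm hK))

/-- `G′_K` is injective. [cite: Balaban1984PropagatorsII, (2.17) p.225; bookkeeping] -/
theorem G_mulVec_injective {a msq : ℝ} (ha : 0 < a) (hm : 0 ≤ msq) (hK : 1 ≤ P.K) :
    Function.Injective ((tower P a msq).G P.K).mulVec := by
  intro v w h
  have h' := congrArg (deltaPrimeK P a msq).mulVec h
  simp only [Matrix.mulVec_mulVec, deltaPrimeK_mul_G P ha hm hK, Matrix.one_mulVec] at h'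
  exact h'

/-! ## §3. `Q′_KG′_K²Q′_K*`: symmetric, `⟨v, ·v⟩ = ‖G′Q′*v‖²_η`, positive definite, invertible; coercivity from that of `Q′G′Q′*` -/

/-- **The matrix of `Q′_KG′_K²Q′_K*`** on `T₁^{(K)} = Site P K` (its (2.69)-kernel is its entry: `B6Ineq268OneScaleTorus.kernelW_eq_entry`).
[cite: Balaban1984PropagatorsII, (2.68)–(2.69) p.235] -/
def qggqK (a msq : ℝ) : Matrix (Site P P.K) (Site P P.K) ℝ :=
  Qk P P.K * (tower P a msq).G P.K * (tower P a msq).G P.K * Qks P P.K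

/-- `Q′G′²Q′* = L^{−Kd}·(Q′*)ᵀ(G′G′)Q′*`. [cite: Balaban1984PropagatorsII, (2.68) p.235; bookkeeping] -/
theorem qggqK_eq (a msq : ℝ) :
    qggqK P a msq = wQ P P.K • ((Qks P P.K)ᵀ * ((tower P a msq).G P.K * (tower P a msq).G P.K) * Qks P P.K) := by
  unfold qggqK
  rw [Qk_eq_smul_transpose, Matrix.smul_mul, Matrix.smul_mul, Matrix.smul_mul, Matrix.mul_assoc (Qks P P.K)ᵀ]

/-- **`Q′G′²Q′*` is symmetric.** [cite: Balaban1984PropagatorsII, p.235 («positive definite»); bookkeeping] -/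
theorem qggqK_transpose {a msq : ℝ} (ha : 0 < a) (hm : 0 ≤ msq) (hK : 1 ≤ P.K) : (qggqK P a msq)ᵀ = qggqK P a msq := by
  rw [qggqK_eq, Matrix.transpose_smul]
  congr 1
  simp only [Matrix.transpose_mul, Matrix.transpose_transpose, G_transpose P ha hm hK, Matrix.mul_assoc]

/-- `⟨u, G′w⟩ = ⟨G′u, w⟩` (plain sums). [cite: Balaban1984PropagatorsII, (2.17) p.225; bookkeeping] -/
theorem dot_G_mulVec {a msq : ℝ} (ha : 0 < a) (hm : 0 ≤ msq) (hK : 1 ≤ P.K) (u w : Site P 0 → ℝ) :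
    u ⬝ᵥ ((tower P a msq).G P.K *ᵥ w) = ((tower P a msq).G P.K *ᵥ u) ⬝ᵥ w := by
  rw [Matrix.dotProduct_mulVec, ← Matrix.mulVec_transpose, G_transpose P ha hm hK]

/-- **`⟨v, Q′G′²Q′*v⟩ = L^{−Kd}‖G′Q′*v‖²`** (= `‖G′Q′*v‖²_η`: `Q′G′²Q′* = (G′Q′*)*(G′Q′*)` for the η-pairing, p. 235).
[cite: Balaban1984PropagatorsII, p.235] -/
theorem form_qggqK {a msq : ℝ} (ha : 0 < a) (hm : 0 ≤ msq) (hK : 1 ≤ P.K) (v : Site P P.K → ℝ) :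
    v ⬝ᵥ (qggqK P a msq *ᵥ v) =
      wQ P P.K * (((tower P a msq).G P.K *ᵥ (Qks P P.K *ᵥ v)) ⬝ᵥ ((tower P a msq).G P.K *ᵥ (Qks P P.K *ᵥ v))) := by
  rw [qggqK_eq, Matrix.smul_mulVec, dotProduct_smul, smul_eq_mul]
  congr 1
  rw [← Matrix.mulVec_mulVec, ← Matrix.mulVec_mulVec, Matrix.dotProduct_mulVec v (Qks P P.K)ᵀ, Matrix.vecMul_transpose,
    ← Matrix.mulVec_mulVec, dot_G_mulVec P ha hm hK]

/-- `⟨v, Q′G′Q′*v⟩ = L^{−Kd}⟨Q′*v, G′Q′*v⟩`. [cite: Balaban1984PropagatorsII, (2.17) p.225; bookkeeping] -/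
theorem form_qgqK {a msq : ℝ} (v : Site P P.K → ℝ) :
    v ⬝ᵥ ((Qk P P.K * (tower P a msq).G P.K * Qks P P.K) *ᵥ v) =
      wQ P P.K * ((Qks P P.K *ᵥ v) ⬝ᵥ ((tower P a msq).G P.K *ᵥ (Qks P P.K *ᵥ v))) := by
  rw [Qk_eq_smul_transpose, Matrix.smul_mul, Matrix.smul_mul, Matrix.smul_mulVec, dotProduct_smul, smul_eq_mul,
    ← Matrix.mulVec_mulVec, ← Matrix.mulVec_mulVec, Matrix.dotProduct_mulVec v (Qks P P.K)ᵀ, Matrix.vecMul_transpose]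

/-- `Q_K*` is injective (`Q_KQ_K* = 1`). [cite: Balaban1983RegularityDecay, (1.5) p.572; bookkeeping] -/
theorem Qks_mulVec_injective : Function.Injective (Qks P P.K).mulVec := by
  intro v w h
  have h' := congrArg (Qk P P.K).mulVec h
  simp only [Matrix.mulVec_mulVec, QkQks P P.K, Matrix.one_mulVec] at h'
  exact h'

/-- a nonzero real vector has positive square sum. [folklore] -/
private theorem dotProduct_self_pos_of_ne_zero {ι : Type*} [Fintype ι] {u : ι → ℝ} (hu : u ≠ 0) : 0 < u ⬝ᵥ u := by
  obtain ⟨i, hi⟩ : ∃ i, u i ≠ 0 := Function.ne_iff.mp hu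
  calc (0 : ℝ) < u i * u i := mul_self_pos.mpr hi
    _ ≤ ∑ j, u j * u j := Finset.single_le_sum (fun j _ => mul_self_nonneg (u j)) (Finset.mem_univ i)
    _ = u ⬝ᵥ u := rfl

/-- **`Q′G′²Q′*` IS POSITIVE DEFINITE** (p. 235: *"Of course the operator Q′G′²Q′* is positive definite"*): `⟨v, Q′G′²Q′*v⟩ > 0` for `v ≠ 0`
(`Q′*` and `G′` injective). [cite: Balaban1984PropagatorsII, p.235] -/
theorem form_qggqK_pos {a msq : ℝ} (ha : 0 < a) (hm : 0 ≤ msq) (hK : 1 ≤ P.K) {v : Site P P.K → ℝ} (hv : v ≠ 0) :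
    0 < v ⬝ᵥ (qggqK P a msq *ᵥ v) := by
  rw [form_qggqK P ha hm hK]
  refine mul_pos (wQ_pos P P.K) (dotProduct_self_pos_of_ne_zero fun h0 => hv ?_)
  have h1 : Qks P P.K *ᵥ v = 0 :=
    G_mulVec_injective P ha hm hK (by rw [h0, Matrix.mulVec_zero])
  exact Qks_mulVec_injective P (by rw [h1, Matrix.mulVec_zero])

/-- **… "SO ITS INVERSE IS WELL DEFINED"**: `Q′_KG′_K²Q′_K*` is an invertible matrix. [cite: Balaban1984PropagatorsII, p.235] -/
theorem qggqK_isUnit {a msq : ℝ} (ha : 0 < a) (hm : 0 ≤ msq) (hK : 1 ≤ P.K) : IsUnit (qggqK P a msq) := by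
  rw [← Matrix.mulVec_injective_iff_isUnit]
  intro v w h
  by_contra hne
  have hpos := form_qggqK_pos P ha hm hK (sub_ne_zero.mpr hne)
  rw [Matrix.mulVec_sub, h, sub_self, dotProduct_zero] at hpos
  exact lt_irrefl _ hpos

/-- **The kernel `(Q′_KG′_K²Q′_K*)⁻¹(y, y′)`** of Proposition 2.3 on the one-scale tower torus, as the `B6.SiteKernel` of the census typing
(the entry of the inverse matrix; (2.69)-weights are 1 on one scale). [cite: Balaban1984PropagatorsII, Prop. 2.3 (2.86)–(2.87) p.238] -/
def cinvK (a msq : ℝ) (Mb R : ℕ) : B6.SiteKernel (oneScaleGeo P Mb R) := ⟨fun y y' => (qggqK P a msq)⁻¹ y y'⟩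

/-- `(Q′G′²Q′*)⁻¹(Q′G′²Q′*) = 1`. [cite: Balaban1984PropagatorsII, p.235] -/
theorem cinvK_mul {a msq : ℝ} (ha : 0 < a) (hm : 0 ≤ msq) (hK : 1 ≤ P.K) : (qggqK P a msq)⁻¹ * qggqK P a msq = 1 :=
  Matrix.nonsing_inv_mul _ ((Matrix.isUnit_iff_isUnit_det _).mp (qggqK_isUnit P ha hm hK))

/-- `(Q′G′²Q′*)(Q′G′²Q′*)⁻¹ = 1`. [cite: Balaban1984PropagatorsII, p.235] -/
theorem mul_cinvK {a msq : ℝ} (ha : 0 < a) (hm : 0 ≤ msq) (hK : 1 ≤ P.K) : qggqK P a msq * (qggqK P a msq)⁻¹ = 1 :=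
  Matrix.mul_nonsing_inv _ ((Matrix.isUnit_iff_isUnit_det _).mp (qggqK_isUnit P ha hm hK))

/-- **Coercivity of `Q′G′²Q′*` from coercivity of `Q′G′Q′*`**: if `⟨v, Q′G′Q′*v⟩ ≥ γ‖v‖²` with `γ ≥ 0` then
`⟨v, Q′G′²Q′*v⟩ = ‖G′Q′*v‖²_η ≥ γ²‖v‖²` (Cauchy–Schwarz: `γ‖v‖² ≤ ⟨Q′*v, G′Q′*v⟩_η ≤ ‖Q′*v‖_η‖G′Q′*v‖_η`, `‖Q′*v‖_η = ‖v‖`).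
[cite: Balaban1984PropagatorsII, p.235; Balaban1984PropagatorsI, p.25 (after (1.44))] -/
theorem coercive_qggqK_of_qgqK {a msq : ℝ} (ha : 0 < a) (hm : 0 ≤ msq) (hK : 1 ≤ P.K) {γ : ℝ} (hγ : 0 ≤ γ)
    (h : Coercive (Qk P P.K * (tower P a msq).G P.K * Qks P P.K) γ) : Coercive (qggqK P a msq) (γ ^ 2) := by
  intro v
  set G := (tower P a msq).G P.K with hG
  set u := Qks P P.K *ᵥ v with hu
  have hw : 0 < wQ P P.K := wQ_pos P P.K
  have h1 : γ * (v ⬝ᵥ v) ≤ wQ P P.K * (u ⬝ᵥ (G *ᵥ u)) := by rw [hu, hG, ← form_qgqK P v]; exact h v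
  have huu : u ⬝ᵥ u = (wQ P P.K)⁻¹ * (v ⬝ᵥ v) := Qks_dot_Qks P P.K v
  have hcs : (u ⬝ᵥ (G *ᵥ u)) ^ 2 ≤ (u ⬝ᵥ u) * ((G *ᵥ u) ⬝ᵥ (G *ᵥ u)) := by
    have hcs' := Finset.sum_mul_sq_le_sq_mul_sq Finset.univ u (G *ᵥ u)
    simpa only [dotProduct, sq] using hcs'
  have hvv : 0 ≤ v ⬝ᵥ v := Finset.sum_nonneg fun i _ => mul_self_nonneg _
  have hGG : 0 ≤ (G *ᵥ u) ⬝ᵥ (G *ᵥ u) := Finset.sum_nonneg fun i _ => mul_self_nonneg _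
  rw [form_qggqK P ha hm hK v, ← hu, ← hG]
  rcases hvv.eq_or_lt with h0 | hpos
  · rw [← h0, mul_zero]
    exact mul_nonneg hw.le hGG
  · have hsq : (γ * (v ⬝ᵥ v)) ^ 2 ≤ (wQ P P.K * (u ⬝ᵥ (G *ᵥ u))) ^ 2 := pow_le_pow_left₀ (mul_nonneg hγ hvv) h1 2
    have key : γ ^ 2 * (v ⬝ᵥ v) * (v ⬝ᵥ v) ≤ wQ P P.K * ((G *ᵥ u) ⬝ᵥ (G *ᵥ u)) * (v ⬝ᵥ v) :=
      calc γ ^ 2 * (v ⬝ᵥ v) * (v ⬝ᵥ v) = (γ * (v ⬝ᵥ v)) ^ 2 := by ring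
        _ ≤ (wQ P P.K * (u ⬝ᵥ (G *ᵥ u))) ^ 2 := hsq
        _ = wQ P P.K ^ 2 * (u ⬝ᵥ (G *ᵥ u)) ^ 2 := by ring
        _ ≤ wQ P P.K ^ 2 * ((u ⬝ᵥ u) * ((G *ᵥ u) ⬝ᵥ (G *ᵥ u))) := mul_le_mul_of_nonneg_left hcs (sq_nonneg _)
        _ = wQ P P.K * ((G *ᵥ u) ⬝ᵥ (G *ᵥ u)) * (v ⬝ᵥ v) * (wQ P P.K * (wQ P P.K)⁻¹) := by rw [huu]; ring
        _ = wQ P P.K * ((G *ᵥ u) ⬝ᵥ (G *ᵥ u)) * (v ⬝ᵥ v) := by rw [mul_inv_cancel₀ hw.ne', mul_one]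
    exact le_of_mul_le_mul_right key hpos

/-! ## §4. Proposition 2.3 VERBATIM on the tower-torus family from ONE input: a uniform lower bound -/

/-- `|y − y|₁ = 0`. [cite: Balaban1984PropagatorsII, (2.46) p.231; bookkeeping] -/
theorem T1_self (j : ℕ) (y : Site P j) : T1 P j y y = 0 := by
  unfold T1
  simp [ccoord_self]

/-- The periodic ℓ¹ distance is a pseudo-distance in the sense of `B4Sect5Torus` (symmetric, zero diagonal, (2.54)).
[cite: Balaban1984PropagatorsII, (2.54) p.233] -/
theorem T1_isPseudoDist (j : ℕ) : IsPseudoDist (T1 P j) := ⟨T1_symm P j, T1_self P j, T1_triangle P j⟩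

/-- The lattice-sum profile of [3] Sect. 5 for `T1`: `Σ_{y′} e^{−t|y−y′|₁} ≤ c₀(t)^d` for every `t > 0` ((2.61)-type count,
`B6Lemma21TowerTorus.sum_exp_T1_le`). [cite: Balaban1984PropagatorsII, (2.61) p.234] -/
theorem T1_sumBound (j : ℕ) : SumBound (T1 P j) (fun t => B6.c0 t 1 ^ P.d) := by
  intro t ht y
  have h := sum_exp_T1_le P j (show 0 < (1 : ℝ) * t by simpa using ht) y
  simpa only [one_mul] using h

/-- **(5.6) of [3] for `A = Q′_KG′_K²Q′_K*`** on `T₁^{(K)}` with the distance `|y − y′|₁`: symmetry (§3), the lower bound `A ≥ γ₀` (INPUT), the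
kernel bound (2.68). [cite: Balaban1983RegularityDecay, (5.6) p.594; Balaban1984PropagatorsII, (2.68) p.235] -/
theorem hyp56_qggqK {a msq : ℝ} (ha : 0 < a) (hm : 0 ≤ msq) (hK : 1 ≤ P.K) {γ₀ C δ : ℝ}
    (hco : Coercive (qggqK P a msq) γ₀) (hdec : ∀ y y', |qggqK P a msq y y'| ≤ C * Real.exp (-(δ * T1 P P.K y y'))) :
    Hyp56 (T1 P P.K) (qggqK P a msq) γ₀ C δ := by
  refine ⟨qggqK_transpose P ha hm hK, fun v => ?_, hdec⟩
  have h := hco v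
  have e1 : v ⬝ᵥ v = ∑ p, v p ^ 2 := by simp [dotProduct, sq]
  have e2 : v ⬝ᵥ (qggqK P a msq *ᵥ v) = ∑ p, v p * (qggqK P a msq).mulVec v p := rfl
  rw [← e1, ← e2]
  exact h

/-- **PROPOSITION 2.3 VERBATIM ON THE ONE-SCALE TOWER-TORUS FAMILY, GIVEN A UNIFORM LOWER BOUND `Q′_KG′_K²Q′_K* ≥ γ₀`.**  For `d ≥ 1`,
odd `L > 1`, `a > 0`, `m² ≥ 0` and `γ₀ > 0` such that every member's `Q′_KG′_K²Q′_K*` is `γ₀`-coercive ([3] (5.6) «A ≥ γ₀I»,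
uniformly in the volume and in K), the census typing `B6.Prop23Printed d` holds for the family `oneScaleGeo` with the GENUINE kernel
`(Q′_KG′_K²Q′_K*)⁻¹(y,y′)` (`cinvK`): witnesses `M₁ = 1`, `δ₁ = 2·rate`, `O(1) = 2/γ₀`, where `rate = B4Sect5Torus.rate (c₀(·)^d) γ₀ C δ₁⁽²·⁶⁸⁾`
— [3] Sect. 5 (`B4Sect5Torus.inv_decay`, finite Combes–Thomas) fed with (2.68) (`ineq268_oneScaleTorus`) and the profile `T1_sumBound`;
`(L^jη)^{−4}(L^{j′}η)^{−d} = 1` on one scale. [cite: Balaban1984PropagatorsII, Prop. 2.3 (2.87) p.238; Balaban1983RegularityDecay, Thm. Sect. 5 (5.6)–(5.7) p.594] -/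
theorem prop23Printed_towerTorus_of_coercive (d L : ℕ) (hd : 1 ≤ d) (hL : Odd L ∧ 1 < L) {a : ℝ} (ha : 0 < a) {msq : ℝ}
    (hmsq : 0 ≤ msq) {γ₀ : ℝ} (hγ : 0 < γ₀) (hcoer : ∀ i : Index d L, Coercive (qggqK i.P a msq) γ₀) :
    B6.Prop23Printed d (fun i : Index d L => oneScaleGeo i.P i.Mb i.R) (fun i => cinvK i.P a msq i.Mb i.R) := by
  obtain ⟨δ₁, C, hδ₁, hC, h268⟩ := ineq268_oneScaleTorus d L hd hL ha hmsq
  have hK0 : ∀ t : ℝ, 0 < t → 0 ≤ (fun t => B6.c0 t 1 ^ d) t := fun t _ => pow_nonneg (B6RandomWalk.c0_nonneg t 1) d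
  have hrate := rate_pos hK0 hγ hC.le hδ₁
  refine ⟨1, 2 * rate (fun t => B6.c0 t 1 ^ d) γ₀ C δ₁, 2 / γ₀, one_pos, by linarith, by positivity, ?_⟩
  intro i _ _ y y'
  have hA : Hyp56 (T1 i.P i.P.K) (qggqK i.P a msq) γ₀ C δ₁ := hyp56_qggqK i.P ha hmsq i.hK (hcoer i) (h268 i)
  have hS : SumBound (T1 i.P i.P.K) (fun t => B6.c0 t 1 ^ d) := by
    have h := T1_sumBound i.P i.P.K
    rwa [i.hPd] at h
  have hdec := inv_decay hK0 hγ hC.le hδ₁ (T1_isPseudoDist i.P i.P.K) hS hA y y'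
  show |(qggqK i.P a msq)⁻¹ y y'| ≤ 2 / γ₀ * (oneScaleGeo i.P i.Mb i.R).len y ^ (-(4 : ℝ)) *
      (oneScaleGeo i.P i.Mb i.R).len y' ^ (-(d : ℝ)) * Real.exp (-(2 * rate (fun t => B6.c0 t 1 ^ d) γ₀ C δ₁ / 2 * T1 i.P i.P.K y y'))
  rw [oneScaleGeo_len, oneScaleGeo_len, Real.one_rpow, Real.one_rpow, mul_one, mul_one,
    show 2 * rate (fun t => B6.c0 t 1 ^ d) γ₀ C δ₁ / 2 = rate (fun t => B6.c0 t 1 ^ d) γ₀ C δ₁ by ring]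
  exact hdec

/-- **The same from a uniform lower bound on `Q′_KG′_KQ′_K*`** (one G′; e.g. from a uniform approximate smooth right inverse of Q′_K with
bounded Δ′-energy, `QGQInverse.qgq_coercive_of_approx_right_inverse`): `Q′G′Q′* ≥ γ ⇒ Q′G′²Q′* ≥ γ²` (`coercive_qggqK_of_qgqK`).
[cite: Balaban1984PropagatorsII, Prop. 2.3 (2.87) p.238; Balaban1984PropagatorsI, p.25] -/
theorem prop23Printed_towerTorus_of_coercive_qgq (d L : ℕ) (hd : 1 ≤ d) (hL : Odd L ∧ 1 < L) {a : ℝ} (ha : 0 < a) {msq : ℝ}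
    (hmsq : 0 ≤ msq) {γ : ℝ} (hγ : 0 < γ)
    (hcoer : ∀ i : Index d L, Coercive (Qk i.P i.P.K * (tower i.P a msq).G i.P.K * Qks i.P i.P.K) γ) :
    B6.Prop23Printed d (fun i : Index d L => oneScaleGeo i.P i.Mb i.R) (fun i => cinvK i.P a msq i.Mb i.R) :=
  prop23Printed_towerTorus_of_coercive d L hd hL ha hmsq (pow_pos hγ 2)
    fun i => coercive_qggqK_of_qgqK i.P ha hmsq i.hK hγ.le (hcoer i)

/-- **LEMMA 2.1 ∧ PROPOSITION 2.2 ∧ PROPOSITION 2.3 — the three verbatim census Props with GENUINE operators on ONE family** (the one-scale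
tower torus: `T1` realised (2.46), `G′_K = Δ′_a⁻¹`, `(Q′_KG′_K²Q′_K*)⁻¹`), modulo the single displayed input `Q′_KG′_KQ′_K* ≥ γ` uniformly:
the antecedent of `B6Ineq288Edge.ineq288_of_printed_lemma21` ((2.88), p. 238 *"We have from Lemma 2.1, Proposition 2.2 and (2.87)"*).
[cite: Balaban1984PropagatorsII, Lemma 2.1 p.234, Prop. 2.2 p.234, Prop. 2.3 p.238, (2.88) p.238] -/
theorem lemma21_prop22_prop23_towerTorus_of_coercive (d L : ℕ) (hd : 1 ≤ d) (hL : Odd L ∧ 1 < L) {a : ℝ} (ha : 0 < a)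
    {msq : ℝ} (hmsq : 0 ≤ msq) {δ₀ : ℝ} (hδ₀ : 0 < δ₀) {γ : ℝ} (hγ : 0 < γ)
    (hcoer : ∀ i : Index d L, Coercive (Qk i.P i.P.K * (tower i.P a msq).G i.P.K * Qks i.P i.P.K) γ) :
    B6.Lemma21Printed d δ₀ (fun i : Index d L => oneScaleGeo i.P i.Mb i.R) ∧
      B6.Prop22Printed (fun i : Index d L => oneScaleGeo i.P i.Mb i.R) (fun i => torusGp i.P a msq i.Mb i.R) ∧
      B6.Prop23Printed d (fun i : Index d L => oneScaleGeo i.P i.Mb i.R) (fun i => cinvK i.P a msq i.Mb i.R) :=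
  ⟨lemma21Printed_towerTorus d L hδ₀, prop22Printed_oneScaleTorus d L hd hL ha hmsq,
    prop23Printed_towerTorus_of_coercive_qgq d L hd hL ha hmsq hγ hcoer⟩

end

end Literature.MathematicalPhysics.QuantumFieldTheory.Balaban1983to89.B6QGGQInvTowerTorus
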